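import Literature.Computability.AlgebraicComplexity.MS2001ClassVarieties
import Literature.RepresentationTheory.AlgebraicGroups.FirstFundamentalTheoremSLProofs
import HarnessLib

/-!
# GCT I, Prop. 7.2 over `ℂ`: forms stabilized by the stabilizer of `E(X)` are Plücker polynomials

Theorem-only companion (no definitions of notions, no named facts) of
`Literature/Computability/AlgebraicComplexity/MS2001ClassVarieties.lean` (K. D. Mulmuley,
M. Sohoni, *Geometric complexity theory I: an approach to the P vs. NP and related problems*,
SIAM J. Comput. **31** (2001) 496–526 [bib `MulmuleySohoniSIAM2001`]; text of record = the
authors' version (AV) of 2001-04-23, `run/shared/lean/pub/val-lit/bip/texts/MS2001-authorversion/`,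
cited as `AV p.N (all.txt Lnnnn)`).

GCT I §7 attaches to the P-vs-NP problem the form `E(X) = ∏_σ det_σ(X)` of the `m × km`
variable matrix `X` (the tree's `msE F m k`, AV p.30) and, with `K = stab(E(X)) ⊆ SL_n(F)`,
`n = km²`, and `[E(X)]` "the set of forms of degree `d` in the entries of `X` that are stabilized
by `K`" (`d = deg E(X) = m·k^m`), states

* **Prop. 7.2** (AV p.31, all.txt L2331–2334): "Any form `h(X) ∈ [E(X)]` can be expressed as a
  homogeneous polynomial in the maximal minors of `X` (which correspond to Plücker coordinates).
  The form `E(X)` is the simplest element of `[E(X)]`, in the sense that its expansion in terms of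
  Plücker coordinates contains only one monomial." Printed proof (AV p.31, L2336–2340): "Any form
  `h ∈ [E(X)]` is stabilized by the group `SL_m(F)` acting on `X` (by multiplication on the left);
  this follows from Proposition 7.1. It follows from classical invariant theory that `h(X)` is a
  polynomial in the `m×m` minors of `X`; this holds in arbitrary characteristic [8]"
  (`[8]` = De Concini–Procesi 1976).

The tree vendors the first assertion, over EVERY algebraically closed field, as the named fact
`MS2001_prop_7_2` (open: the first fundamental theorem for `SL_m` in arbitrary characteristic is
not in the tree). THIS FILE PROVES ITS INSTANCE `F = ℂ` — `MS2001_prop_7_2_complex` — following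
the printed proof, with "classical invariant theory" supplied by the tree's PROVED first
fundamental theorem for `SL_N(ℂ)` (`Literature.RepresentationTheory.AlgebraicGroups.
Sturmfels1993_thm321_FFT_SL_holds`, Sturmfels 1993 Thm. 3.2.1, via Cayley's Ω-process — a
characteristic-zero argument, which is why only the `ℂ` instance is reached here):

1. (private plumbing) left multiplication `X ↦ gX` by `g ∈ SL_m` is the linear substitution by
   the block matrix `gᵀ ⊗ₖ 1` on the `m·(m·k)` entries, of determinant `det(g)^{m k} = 1`;
2. (`linSubst_blockRow_msE`, `linSubst_blockRow_eq_self_of_mem_fixedForms`) it fixes `E(X)`: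
   each `det_σ(gX) = det g · det_σ(X)` — so it lies in `SL_n(ℂ) ∩ stab(E(X))`, and every
   `h ∈ [E(X)]` satisfies `h(gX) = h(X)`, `g ∈ SL_m(ℂ)` (the part of Prop. 7.1 the proof uses:
   `S ≅ SL_m(F)` sits inside `K`);
3. (`rename_mem_slInvariantSubalgebra_of_mem_fixedForms`) after re-indexing the columns
   `Fin m × Fin k ≃ Fin (m·k)` this is the left-translation action of
   `FirstFundamentalTheoremSL.lean`, so `h` is an `SL_m(ℂ)`-invariant of the generic `m × (m·k)`
   matrix and the FFT (`mem_adjoin_maximalMinor_of_mem_slInvariantSubalgebra`, the homogeneous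
   FFT without the side condition `N ≤ M`) puts it in the subalgebra generated by the maximal
   minors, which re-index to the tree's `msMaximalMinor ℂ m k`.

No definitions are introduced (the block matrix and the re-indexing are written out), no named
facts, no instances, no notation.

The second assertion of Prop. 7.2 is definitional in the tree (`msE_eq_prod_msMaximalMinor`).
Nothing here touches the arbitrary-characteristic fact `MS2001_prop_7_2` (no partial discharge of
a named fact is possible or attempted); this is the `ℂ` instance as a cited theorem, as
`MS2001_thm_4_7_complex` is for Thm. 4.7.

HONEST FRAMING. A kernel instance of one printed invariant-theoretic statement about GCT I's
P-vs-NP form `E(X)`; it is not an obstruction, says nothing about the conjectures of GCT I §7,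
and neither VP ≠ VNP nor P ≠ NP is proved here or anywhere in the tree.

## References

* K. D. Mulmuley, M. Sohoni, *Geometric complexity theory I*, SIAM J. Comput. 31 (2001)
  496–526, §7, Prop. 7.1, Prop. 7.2 (authors' version p.31). [MulmuleySohoniSIAM2001]
* B. Sturmfels, *Algorithms in Invariant Theory*, Springer 1993, Thm. 3.2.1 (first fundamental
  theorem for `SL`). [Sturmfels1993]
* C. De Concini, C. Procesi, *A characteristic free approach to invariant theory*, Adv. Math. 21
  (1976) 330–354 (the arbitrary-characteristic FFT cited as [8] in GCT I; not used here).

## Tree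

`msE`, `msMaximalMinor`, `fixedForms`, `slSubgroup`, `linStabilizer`, `linSubst`, `linSubstRep`
(`Literature/Computability/AlgebraicComplexity`); `leftTranslate`, `slInvariantSubalgebra`,
`maximalMinor`, `mem_adjoin_maximalMinor_of_isHomogeneous`
(`Literature/RepresentationTheory/AlgebraicGroups/FirstFundamentalTheoremSL{,Proofs}.lean`).
Standard axioms only.
-/

noncomputable section

open MvPolynomial
open scoped Kronecker

namespace Literature.Computability.AlgebraicComplexity

open Literature.RepresentationTheory.AlgebraicGroups

namespace MS2001Prop72

variable {m kk : ℕ}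

/-! ### The block substitution `X ↦ gX` (written out: `gᵀ ⊗ₖ 1` on `Fin m × (Fin m × Fin k)`) -/

/-- Entries of the block matrix: `(gᵀ ⊗ₖ 1)_{p q} = g_{q₁ p₁} · [p₂ = q₂]`. [folklore] -/
private theorem blockRow_apply (g : Matrix (Fin m) (Fin m) ℂ) (p q : Fin m × (Fin m × Fin kk)) :
    (g.transpose ⊗ₖ (1 : Matrix (Fin m × Fin kk) (Fin m × Fin kk) ℂ)) p q =
      g q.1 p.1 * (if p.2 = q.2 then 1 else 0) := by
  obtain ⟨p₁, p₂⟩ := p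
  obtain ⟨q₁, q₂⟩ := q
  simp [Matrix.transpose_apply, Matrix.one_apply]

/-- `det (gᵀ ⊗ₖ 1) = det(g)^{m·k}`; in particular it is `1` for `g ∈ SL_m`. [folklore] -/
private theorem det_blockRow (g : Matrix (Fin m) (Fin m) ℂ) :
    (g.transpose ⊗ₖ (1 : Matrix (Fin m × Fin kk) (Fin m × Fin kk) ℂ)).det =
      g.det ^ Fintype.card (Fin m × Fin kk) := by
  rw [Matrix.det_kronecker, Matrix.det_transpose, Matrix.det_one, one_pow, mul_one]

/-- The substitution by `gᵀ ⊗ₖ 1` on a variable: `x_{(r,c)} ↦ ∑_{r'} g_{r r'} • x_{(r',c)}` — the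
`(r,c)` entry of `gX`. [folklore] -/
private theorem linSubst_blockRow_X (g : Matrix (Fin m) (Fin m) ℂ) (q : Fin m × (Fin m × Fin kk)) :
    linSubst (Fin m × (Fin m × Fin kk)) ℂ
        (g.transpose ⊗ₖ (1 : Matrix (Fin m × Fin kk) (Fin m × Fin kk) ℂ)) (X q) =
      ∑ r' : Fin m, g q.1 r' • X (r', q.2) := by
  rw [linSubst_X, Fintype.sum_prod_type]
  refine Finset.sum_congr rfl fun r' _ => ?_
  simp_rw [blockRow_apply]
  rw [Finset.sum_eq_single q.2]
  · simp
  · intro c _ hc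
    simp [hc]
  · intro h
    exact absurd (Finset.mem_univ _) h

/-- **Left multiplication multiplies every column-determinant by `det g`**: for the `m × m` matrix
of variables on the columns `e 0, …, e (m-1)`, substituting `X ↦ gX` gives `det g · det`
(the relative invariance of maximal minors; GCT I proof of Prop. 7.2, AV p.31). [folklore] -/
private theorem linSubst_blockRow_det_of (g : Matrix (Fin m) (Fin m) ℂ)
    (e : Fin m → Fin m × Fin kk) :
    linSubst (Fin m × (Fin m × Fin kk)) ℂ
        (g.transpose ⊗ₖ (1 : Matrix (Fin m × Fin kk) (Fin m × Fin kk) ℂ))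
        (Matrix.of fun r c : Fin m => (X (r, e c) : MvPolynomial (Fin m × (Fin m × Fin kk)) ℂ)).det =
      C g.det *
        (Matrix.of fun r c : Fin m => (X (r, e c) : MvPolynomial (Fin m × (Fin m × Fin kk)) ℂ)).det := by
  rw [AlgHom.map_det]
  have hmat : (linSubst (Fin m × (Fin m × Fin kk)) ℂ
        (g.transpose ⊗ₖ (1 : Matrix (Fin m × Fin kk) (Fin m × Fin kk) ℂ))).mapMatrix
      (Matrix.of fun r c : Fin m => (X (r, e c) : MvPolynomial (Fin m × (Fin m × Fin kk)) ℂ)) =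
      g.map C *
        Matrix.of fun r c : Fin m => (X (r, e c) : MvPolynomial (Fin m × (Fin m × Fin kk)) ℂ) := by
    ext r c
    rw [AlgHom.mapMatrix_apply, Matrix.map_apply, Matrix.of_apply, linSubst_blockRow_X,
      Matrix.mul_apply]
    simp only [Matrix.map_apply, Matrix.of_apply, smul_eq_C_mul]
  rw [hmat, Matrix.det_mul]
  congr 1
  exact (RingHom.map_det (C : ℂ →+* MvPolynomial (Fin m × (Fin m × Fin kk)) ℂ) g).symm

/-- **`X ↦ gX`, `g ∈ SL_m`, fixes `E(X)`** (each factor `det_σ(gX) = det g · det_σ(X) = det_σ(X)`):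
the subgroup `S ≅ SL_m(F)` ("transformations of the form `X → AX`") of Prop. 7.1 stabilizes
`E(X)`; rendered with the block matrix `gᵀ ⊗ₖ 1` of the substitution `X ↦ gX`.
[cite: MulmuleySohoniSIAM2001, Prop. 7.1 and proof of Prop. 7.2 (AV p.31, all.txt L2262, L2336)] -/
theorem linSubst_blockRow_msE (g : Matrix (Fin m) (Fin m) ℂ) (hg : g.det = 1) :
    linSubst (Fin m × (Fin m × Fin kk)) ℂ
        (g.transpose ⊗ₖ (1 : Matrix (Fin m × Fin kk) (Fin m × Fin kk) ℂ)) (msE ℂ m kk) =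
      msE ℂ m kk := by
  unfold msE
  rw [map_prod]
  refine Finset.prod_congr rfl fun σ _ => ?_
  rw [linSubst_blockRow_det_of, hg, map_one, one_mul]

/-- The block matrix of `g ∈ SL_m(ℂ)` is (the matrix of) an element of `SL_n(ℂ)`, `n = km²`, in the
tree's acting group (through Mathlib's `SpecialLinearGroup.toGL`). [folklore] -/
private theorem exists_slSubgroup_coe_eq_blockRow (g : Matrix.SpecialLinearGroup (Fin m) ℂ) :
    ∃ γ ∈ slSubgroup (Fin m × (Fin m × Fin kk)) ℂ,
      ((γ : GL (Fin m × (Fin m × Fin kk)) ℂ) : Matrix _ _ ℂ) =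
        (g : Matrix (Fin m) (Fin m) ℂ).transpose ⊗ₖ (1 : Matrix (Fin m × Fin kk) (Fin m × Fin kk) ℂ) :=
  ⟨Matrix.SpecialLinearGroup.toGL
      ⟨(g : Matrix (Fin m) (Fin m) ℂ).transpose ⊗ₖ (1 : Matrix (Fin m × Fin kk) (Fin m × Fin kk) ℂ),
        by rw [det_blockRow, g.det_coe, one_pow]⟩,
    ⟨_, rfl⟩, rfl⟩

/-- **Every `h ∈ [E(X)]` is invariant under `X ↦ gX`, `g ∈ SL_m(ℂ)`** ("Any form `h ∈ [E(X)]` is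
stabilized by the group `SL_m(F)` acting on `X` (by multiplication on the left); this follows
from Proposition 7.1", AV p.31).
[cite: MulmuleySohoniSIAM2001, proof of Prop. 7.2 (AV p.31, all.txt L2336)] -/
theorem linSubst_blockRow_eq_self_of_mem_fixedForms {d : ℕ}
    {h : MvPolynomial (Fin m × (Fin m × Fin kk)) ℂ}
    (hh : h ∈ fixedForms (slSubgroup (Fin m × (Fin m × Fin kk)) ℂ) (msE ℂ m kk) d)
    (g : Matrix.SpecialLinearGroup (Fin m) ℂ) :
    linSubst (Fin m × (Fin m × Fin kk)) ℂ
        ((g : Matrix (Fin m) (Fin m) ℂ).transpose ⊗ₖ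
          (1 : Matrix (Fin m × Fin kk) (Fin m × Fin kk) ℂ)) h = h := by
  obtain ⟨γ, hγ, hcoe⟩ := exists_slSubgroup_coe_eq_blockRow (kk := kk) g
  have hstab : linSubstRep _ ℂ γ (msE ℂ m kk) = msE ℂ m kk := by
    rw [linSubstRep_apply, hcoe]
    exact linSubst_blockRow_msE _ g.det_coe
  have := (mem_fixedForms_iff.mp hh).2 γ hγ hstab
  rwa [linSubstRep_apply, hcoe] at this

/-! ### Re-indexing the columns and the first fundamental theorem -/

/-- **Transport of the action**: re-indexing the columns by `Fin m × Fin k ≃ Fin (m·k)` after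
`X ↦ gX` is left translation by `g` (the action of `FirstFundamentalTheoremSL.lean`) after
re-indexing — both send `x_{(r,c)}` to `∑_{r'} g_{r r'} x_{(r', c)}`. [folklore] -/
private theorem rename_linSubst_blockRow (g : Matrix (Fin m) (Fin m) ℂ)
    (h : MvPolynomial (Fin m × (Fin m × Fin kk)) ℂ) :
    rename (Equiv.prodCongr (Equiv.refl (Fin m)) finProdFinEquiv)
        (linSubst (Fin m × (Fin m × Fin kk)) ℂ
          (g.transpose ⊗ₖ (1 : Matrix (Fin m × Fin kk) (Fin m × Fin kk) ℂ)) h) =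
      leftTranslate (M := m * kk) g (rename (Equiv.prodCongr (Equiv.refl (Fin m)) finProdFinEquiv) h) := by
  have key : (rename (Equiv.prodCongr (Equiv.refl (Fin m)) finProdFinEquiv)).comp
        (linSubst (Fin m × (Fin m × Fin kk)) ℂ
          (g.transpose ⊗ₖ (1 : Matrix (Fin m × Fin kk) (Fin m × Fin kk) ℂ))) =
      (leftTranslate (M := m * kk) g).comp
        (rename (Equiv.prodCongr (Equiv.refl (Fin m)) finProdFinEquiv)) := by
    refine MvPolynomial.algHom_ext fun q => ?_
    rw [AlgHom.comp_apply, AlgHom.comp_apply, linSubst_blockRow_X, map_sum, rename_X,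
      leftTranslate_X, Equiv.prodCongr_apply, Equiv.coe_refl, Prod.map_fst, Prod.map_snd]
    refine Finset.sum_congr rfl fun r' _ => ?_
    rw [map_smul, rename_X, smul_eq_C_mul]
    rfl
  exact congrArg (fun φ : MvPolynomial (Fin m × (Fin m × Fin kk)) ℂ →ₐ[ℂ]
      MvPolynomial (Fin m × Fin (m * kk)) ℂ => φ h) key

/-- **A form of `[E(X)]`, re-indexed, is an `SL_m(ℂ)`-invariant of the generic `m × (m·k)`
matrix** — the hypothesis of "classical invariant theory" in the printed proof.
[cite: MulmuleySohoniSIAM2001, proof of Prop. 7.2 (AV p.31, all.txt L2336–2338)] -/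
theorem rename_mem_slInvariantSubalgebra_of_mem_fixedForms {d : ℕ}
    {h : MvPolynomial (Fin m × (Fin m × Fin kk)) ℂ}
    (hh : h ∈ fixedForms (slSubgroup (Fin m × (Fin m × Fin kk)) ℂ) (msE ℂ m kk) d) :
    rename (Equiv.prodCongr (Equiv.refl (Fin m)) finProdFinEquiv) h ∈
      slInvariantSubalgebra m (m * kk) := by
  rw [mem_slInvariantSubalgebra]
  intro g
  rw [← rename_linSubst_blockRow, linSubst_blockRow_eq_self_of_mem_fixedForms hh g]

/-- **Un-indexing a maximal minor gives a maximal minor of `X`** in the tree's §7 coordinates: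
`rename e⁻¹ (minor_c) = msMaximalMinor (finProdFinEquiv⁻¹ ∘ c)`. [folklore] -/
private theorem rename_symm_maximalMinor (c : Fin m → Fin (m * kk)) :
    rename (Equiv.prodCongr (Equiv.refl (Fin m)) finProdFinEquiv).symm (maximalMinor m (m * kk) c) =
      msMaximalMinor ℂ m kk (fun i => finProdFinEquiv.symm (c i)) := by
  unfold maximalMinor msMaximalMinor
  rw [AlgHom.map_det]
  congr 1
  ext r i
  simp only [AlgHom.mapMatrix_apply, Matrix.map_apply, Matrix.of_apply, rename_X,
    Equiv.prodCongr_symm, Equiv.prodCongr_apply, Equiv.refl_symm, Equiv.coe_refl, Prod.map_apply,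
    id_eq]

/-- **The first fundamental theorem for `SL_N(ℂ)`, homogeneous form, without the side condition
`N ≤ M`**: a homogeneous polynomial in the entries of an `N × M` matrix that is invariant under
left multiplication by `SL_N(ℂ)` is a polynomial in the maximal minors (Sturmfels 1993
Thm. 3.2.1, PROVED in the tree by the Ω-process as `mem_adjoin_maximalMinor_of_isHomogeneous`
for `N ≥ 1`; for `N = 0` every polynomial is a constant). [cite: Sturmfels1993, Thm. 3.2.1] -/
theorem mem_adjoin_maximalMinor_of_mem_slInvariantSubalgebra {N M n : ℕ}
    {f : MvPolynomial (Fin N × Fin M) ℂ} (hf : f ∈ slInvariantSubalgebra N M)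
    (hn : f.IsHomogeneous n) :
    f ∈ Algebra.adjoin ℂ (Set.range (maximalMinor N M)) := by
  rcases Nat.eq_zero_or_pos N with hN | hN
  · subst hN
    rw [MvPolynomial.eq_C_of_isEmpty f]
    exact Subalgebra.algebraMap_mem _ _
  · exact mem_adjoin_maximalMinor_of_isHomogeneous hf hn hN

end MS2001Prop72

open MS2001Prop72 in
/-- **GCT I, Prop. 7.2 (first assertion) over `ℂ`, PROVED.** "Any form `h(X) ∈ [E(X)]` can be
expressed as a homogeneous polynomial in the maximal minors of `X` (which correspond to Plücker
coordinates)" (AV p.31, all.txt L2331–2334), `[E(X)]` = the degree-`d` forms (`d = m·k^m =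
deg E(X)`) in the `n = km²` entries of `X` stabilized by `K = stab(E(X)) ⊆ SL_n` — here at
`F = ℂ`, in the tree's rendering of `MS2001_prop_7_2`: every
`h ∈ fixedForms (slSubgroup _ ℂ) (msE ℂ m k) (m * k ^ m)` lies in `Algebra.adjoin ℂ (range
(msMaximalMinor ℂ m k))`. Proof as printed: `h` is invariant under `X ↦ gX`, `g ∈ SL_m(ℂ)`
(Prop. 7.1's `S ⊆ K`), then the first fundamental theorem for `SL_m` — in the tree Sturmfels
1993 Thm. 3.2.1 over `ℂ` (`Sturmfels1993_thm321_FFT_SL_holds`, Cayley Ω-process); the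
arbitrary-characteristic statement `MS2001_prop_7_2` (De Concini–Procesi) is NOT discharged by
this. [cite: MulmuleySohoniSIAM2001, Prop. 7.2 (AV p.31, all.txt L2331); Sturmfels1993 Thm. 3.2.1] -/
theorem MS2001_prop_7_2_complex (m kk : ℕ) :
    ∀ h ∈ fixedForms (slSubgroup (Fin m × (Fin m × Fin kk)) ℂ) (msE ℂ m kk) (m * kk ^ m),
      h ∈ Algebra.adjoin ℂ (Set.range (msMaximalMinor ℂ m kk)) := by
  intro h hh
  have hhom : h.IsHomogeneous (m * kk ^ m) := (mem_fixedForms_iff.mp hh).1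
  -- the re-indexed form is an `SL_m`-invariant, hence a bracket polynomial (FFT)
  have hmem : rename (Equiv.prodCongr (Equiv.refl (Fin m)) finProdFinEquiv) h ∈
      Algebra.adjoin ℂ (Set.range (maximalMinor m (m * kk))) :=
    mem_adjoin_maximalMinor_of_mem_slInvariantSubalgebra
      (rename_mem_slInvariantSubalgebra_of_mem_fixedForms hh) hhom.rename_isHomogeneous
  -- un-index: `h = rename e⁻¹ (rename e h)` lies in the image subalgebra, generated by the
  -- un-indexed minors, which are maximal minors of `X`
  have hback : rename (Equiv.prodCongr (Equiv.refl (Fin m)) finProdFinEquiv).symm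
      (rename (Equiv.prodCongr (Equiv.refl (Fin m)) finProdFinEquiv) h) = h := by
    rw [rename_rename, Equiv.symm_comp_self, rename_id, AlgHom.id_apply]
  rw [← hback]
  have himg : rename (Equiv.prodCongr (Equiv.refl (Fin m)) finProdFinEquiv).symm
        (rename (Equiv.prodCongr (Equiv.refl (Fin m)) finProdFinEquiv) h) ∈
      (Algebra.adjoin ℂ (Set.range (maximalMinor m (m * kk)))).map
        (rename (Equiv.prodCongr (Equiv.refl (Fin m)) finProdFinEquiv).symm :
          MvPolynomial (Fin m × Fin (m * kk)) ℂ →ₐ[ℂ] MvPolynomial (Fin m × (Fin m × Fin kk)) ℂ) :=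
    Subalgebra.mem_map.mpr ⟨_, hmem, rfl⟩
  rw [AlgHom.map_adjoin] at himg
  refine Algebra.adjoin_mono ?_ himg
  rintro _ ⟨_, ⟨c, rfl⟩, rfl⟩
  exact ⟨fun i => finProdFinEquiv.symm (c i), (rename_symm_maximalMinor c).symm⟩

end Literature.Computability.AlgebraicComplexity

end
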